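import Literature.AlgebraicTopology.CharacteristicClasses.LineThomClassUniqueness
import Literature.AlgebraicTopology.CharacteristicClasses.ProjectiveCompletionMap
import HarnessLib

/-!
# The Euler class (= first Chern class) of a complex line bundle and its naturality

D. Husemoller, *Fibre Bundles* (3rd ed. 1994), Ch. 17 §2 Def. 2.6 / §3 Prop. 3.3 ((C₁) for line
bundles) with J. Milnor, J. Stasheff, *Characteristic Classes* (1974), §9 (the Euler class as the
image of the Thom class under `H(E, E₀) → H(E) ≅ H(B)`, i.e. restriction along the zero section)
and §14 p. 158 ("the top Chern class is the Euler class"): for a complex LINE bundle `λ` over a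
paracompact Hausdorff base,

* `thomClass m ∈ H²(P(λ ⊕ ℂ); R)` — THE Thom class (exists: `exists_isThomClass`; unique:
  `IsThomClass.unique`), `isThomClass_thomClass`, `IsThomClass.eq_thomClass`;
* **`eulerClass m = s₀^* (thomClass m) ∈ H²(B; R)`** — the Euler class, i.e. `c₁(λ)` for `m = 1`;
* **naturality under pull-back** (`thomClass_pullback`, `eulerClass_pullback`): for `f : B' → B`,
  the bundle map `P(f^*λ ⊕ ℂ) → P(λ ⊕ ℂ)` pulls the Thom class back to the Thom class (it is one:
  compatibility with the sections at infinity and the fibres, `ProjectiveCompletionMap`, and the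
  choice-freeness of the fibre generators `map_projProd_omegaStd`; then uniqueness over `B'`), so
  `e(f^*λ) = f^* e(λ)`;
* **invariance under isomorphism** (`thomClass_iso`, `eulerClass_iso`): a fibrewise linear
  isomorphism `λ₁ ≅ λ₂` over `B` with continuous total map (the two bundles may have different
  model fibres) identifies the Thom classes, so `e(λ₁) = e(λ₂)`.

Everything is proved; no named facts.

## References

* D. Husemoller, *Fibre Bundles*, GTM 20, Springer 1994, Ch. 17 §2 Def. 2.6, §3 Prop. 3.3. [HusemollerFibreBundles1994]
* J. Milnor, J. Stasheff, *Characteristic Classes*, PUP 1974, §9, §10 Thm. 10.4, §14 p. 158. [MilnorStasheff1974]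
-/

noncomputable section

open CategoryTheory Function Set Bundle Literature.AlgebraicTopology.SingularHomology
open scoped LinearAlgebra.Projectivization

universe u

namespace Literature.AlgebraicTopology.CharacteristicClasses

/-- The fibres of a pull-back of a bundle of abelian groups are abelian groups (Mathlib registers
only the monoid structure). [folklore] -/
instance Pullback.instAddCommGroup {B B' : Type*} {E : B → Type*} [∀ b, AddCommGroup (E b)] (f : B' → B)
    (x : B') : AddCommGroup ((f *ᵖ E) x) :=
  inferInstanceAs (AddCommGroup (E (f x)))

variable {B : Type u} [TopologicalSpace B] (F : Type u) [NormedAddCommGroup F] [NormedSpace ℂ F] [FiniteDimensional ℂ F]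
  (E : B → Type u) [∀ b, AddCommGroup (E b)] [∀ b, Module ℂ (E b)]
  [TopologicalSpace (TotalSpace F E)] [∀ b, TopologicalSpace (E b)] [FiberBundle F E] [VectorBundle ℂ F E]
  (hF : Module.finrank ℂ F = 1) (R : Type u) [CommRing R]

section Thom

variable [T2Space B] [ParacompactSpace B]

/-- **The Thom class `t(m) ∈ H²(P(λ ⊕ ℂ); R)`** of the line bundle `λ` (generator `m`): the unique
class killed by the section at infinity and restricting to `ω_b(m)` on every fibre.
[cite: MilnorStasheff1974, §10 Thm. 10.4] -/
def thomClass (m : R) : singularCohomology R R (ProjCompl F E) 2 := (exists_isThomClass F E hF R m).choose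

/-- The Thom class is a Thom class. [cite: MilnorStasheff1974, §10 Thm. 10.4] -/
theorem isThomClass_thomClass (m : R) : IsThomClass F E hF R m (thomClass F E hF R m) :=
  (exists_isThomClass F E hF R m).choose_spec

variable {F E R} in
/-- Every Thom class is THE Thom class. [cite: MilnorStasheff1974, §10 Thm. 10.4] -/
theorem IsThomClass.eq_thomClass {m : R} {t : singularCohomology R R (ProjCompl F E) 2} (ht : IsThomClass F E hF R m t) :
    t = thomClass F E hF R m :=
  ht.unique hF R (isThomClass_thomClass F E hF R m)

/-- **The Euler class `e(m) = s₀^* t(m) ∈ H²(B; R)` of the line bundle** — for `m = 1` the FIRST CHERN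
CLASS `c₁(λ)` (Milnor–Stasheff §14: `c₁ = e` for line bundles; Husemoller Ch. 17 Def. 2.6).
[cite: MilnorStasheff1974, §14 p. 158] -/
def eulerClass (m : R) : singularCohomology R R B 2 :=
  singularCohomology.map R R (complZero F E) 2 (thomClass F E hF R m)

end Thom

/-! ### Naturality under pull-back -/

section Pullback

variable {B' : Type u} [TopologicalSpace B'] (f : C(B', B))

/-- The bundle map `P(f^*λ ⊕ ℂ) → P(λ ⊕ ℂ)`, `⟨b', ℓ⟩ ↦ ⟨f b', ℓ⟩`. [cite: HusemollerFibreBundles1994, Ch. 17 §2] -/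
def pullbackComplMap : C(ProjCompl F (⇑f *ᵖ E), ProjCompl F E) :=
  complMapC (F₁ := F) (F₂ := F) (E₁ := ⇑f *ᵖ E) (E₂ := E) (g := f)
    (fun b' ↦ (LinearMap.id : (⇑f *ᵖ E) b' →ₗ[ℂ] E (f b'))) (fun _ ↦ injective_id)
    (Pullback.continuous_lift F E f)

omit [FiniteDimensional ℂ F] in
/-- The fibre generators of `f^*λ` are those of `λ`: `ω'_{b'} = ω_{f b'}`. [folklore] -/
theorem omegaFib_pullback (b' : B') (m : R) :
    omegaFib F (⇑f *ᵖ E) hF R R b' m = omegaFib F E hF R R (f b') m :=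
  (map_projProd_omegaModel F E hF R R (f b')
    (linEquivAt ℂ F (⇑f *ᵖ E) (trivializationAt F (⇑f *ᵖ E) b') b') m)

/-- **The bundle map of a pull-back pulls Thom classes back to Thom classes.** [cite: HusemollerFibreBundles1994, Ch. 17 Prop. 3.3] -/
theorem isThomClass_map_pullbackComplMap {m : R} {t : singularCohomology R R (ProjCompl F E) 2}
    (ht : IsThomClass F E hF R m t) :
    IsThomClass F (⇑f *ᵖ E) hF R m (singularCohomology.map R R (pullbackComplMap F E f) 2 t) where
  map_complInf := by
    have hc : (pullbackComplMap F E f).comp (complInf F (⇑f *ᵖ E) hF) = (complInf F E hF).comp f :=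
      ContinuousMap.ext fun b' ↦ complMap_complInf (F₁ := F) (F₂ := F) (E₁ := ⇑f *ᵖ E) (E₂ := E) (g := f)
        (fun b' ↦ (LinearMap.id : (⇑f *ᵖ E) b' →ₗ[ℂ] E (f b'))) (fun _ ↦ injective_id) hF hF b'
    rw [← ModuleCat.comp_apply, ← singularCohomology.map_comp, hc, singularCohomology.map_comp, ModuleCat.comp_apply,
      ht.map_complInf, map_zero]
  map_complFibreIncl b' := by
    have hc : (pullbackComplMap F E f).comp (complFibreIncl F (⇑f *ᵖ E) b') = complFibreIncl F E (f b') := by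
      ext1 ℓ
      change complMap F F (⇑f *ᵖ E) E (g := f) (fun b' ↦ (LinearMap.id : (⇑f *ᵖ E) b' →ₗ[ℂ] E (f b')))
        (fun _ ↦ injective_id) ⟨b', ℓ⟩ = ⟨f b', ℓ⟩
      induction ℓ using Projectivization.ind with
      | h v hv => rfl
    rw [← ModuleCat.comp_apply, ← singularCohomology.map_comp, hc]
    exact (ht.map_complFibreIncl (f b')).trans (omegaFib_pullback F E hF R f b' m).symm

variable [T2Space B] [ParacompactSpace B] [T2Space B'] [ParacompactSpace B']

/-- **`t(f^*λ) = (P f)^* t(λ)`.** [cite: HusemollerFibreBundles1994, Ch. 17 Prop. 3.3] -/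
theorem thomClass_pullback (m : R) :
    thomClass F (⇑f *ᵖ E) hF R m = singularCohomology.map R R (pullbackComplMap F E f) 2 (thomClass F E hF R m) :=
  ((isThomClass_map_pullbackComplMap F E hF R f (isThomClass_thomClass F E hF R m)).eq_thomClass hF).symm

/-- **Naturality of the Euler / first Chern class of line bundles: `e(f^*λ) = f^* e(λ)`**
(Husemoller (C₁), Prop. 3.3). [cite: HusemollerFibreBundles1994, Ch. 17 Prop. 3.3] -/
theorem eulerClass_pullback (m : R) :
    eulerClass F (⇑f *ᵖ E) hF R m = singularCohomology.map R R f 2 (eulerClass F E hF R m) := by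
  have hc : (pullbackComplMap F E f).comp (complZero F (⇑f *ᵖ E)) = (complZero F E).comp f :=
    ContinuousMap.ext fun b' ↦ complMap_complZero (F₁ := F) (F₂ := F) (E₁ := ⇑f *ᵖ E) (E₂ := E) (g := f)
      (fun b' ↦ (LinearMap.id : (⇑f *ᵖ E) b' →ₗ[ℂ] E (f b'))) (fun _ ↦ injective_id) b'
  rw [eulerClass, eulerClass, thomClass_pullback, ← ModuleCat.comp_apply, ← singularCohomology.map_comp, hc,
    singularCohomology.map_comp, ModuleCat.comp_apply]

end Pullback

/-! ### Invariance under isomorphism -/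

section Iso

variable (F₂ : Type u) [NormedAddCommGroup F₂] [NormedSpace ℂ F₂] [FiniteDimensional ℂ F₂]
  (E₂ : B → Type u) [∀ b, AddCommGroup (E₂ b)] [∀ b, Module ℂ (E₂ b)]
  [TopologicalSpace (TotalSpace F₂ E₂)] [∀ b, TopologicalSpace (E₂ b)] [FiberBundle F₂ E₂] [VectorBundle ℂ F₂ E₂]
  (hF₂ : Module.finrank ℂ F₂ = 1)
  (φ : ∀ b, E b ≃L[ℂ] E₂ b)
  (hΨ : Continuous fun q : TotalSpace F E ↦ (⟨(ContinuousMap.id B) q.proj, φ q.proj q.2⟩ : TotalSpace F₂ E₂))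

/-- The bundle map `P(λ₁ ⊕ ℂ) → P(λ₂ ⊕ ℂ)` of a fibrewise isomorphism over `B`. [cite: HusemollerFibreBundles1994, Ch. 3 §2] -/
def isoComplMap : C(ProjCompl F E, ProjCompl F₂ E₂) :=
  complMapC (F₁ := F) (F₂ := F₂) (E₁ := E) (E₂ := E₂) (g := ContinuousMap.id B)
    (fun b ↦ ((φ b : E b →L[ℂ] E₂ b) : E b →ₗ[ℂ] E₂ b)) (fun b ↦ (φ b).injective) hΨ

omit [FiniteDimensional ℂ F] [FiniteDimensional ℂ F₂] in
/-- **`ℙ(φ_b × 𝟙)^* ω²_b = ω¹_b`**: the fibre generators do not depend on the presentation (fixed model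
line, `map_projProd_omegaStd`). [folklore] -/
theorem map_projProd₂_omegaFib (b : B) (m : R) :
    singularCohomology.map R R (projProd₂ (φ b)) 2 (omegaFib F₂ E₂ hF₂ R R b m) = omegaFib F E hF R R b m := by
  rw [omegaFib, ← ModuleCat.comp_apply, ← singularCohomology.map_comp, ← projProd_trans]
  exact map_projProd_omegaStd F E hF R R b _ m

/-- **The bundle map of an isomorphism pulls Thom classes back to Thom classes.** [cite: HusemollerFibreBundles1994, Ch. 17 Prop. 3.3] -/
theorem isThomClass_map_isoComplMap {m : R} {t : singularCohomology R R (ProjCompl F₂ E₂) 2}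
    (ht : IsThomClass F₂ E₂ hF₂ R m t) :
    IsThomClass F E hF R m (singularCohomology.map R R (isoComplMap F E F₂ E₂ φ hΨ) 2 t) where
  map_complInf := by
    have hc : (isoComplMap F E F₂ E₂ φ hΨ).comp (complInf F E hF) = complInf F₂ E₂ hF₂ :=
      ContinuousMap.ext fun b ↦ complMap_complInf (F₁ := F) (F₂ := F₂) (E₁ := E) (E₂ := E₂) (g := ContinuousMap.id B)
        (fun b ↦ ((φ b : E b →L[ℂ] E₂ b) : E b →ₗ[ℂ] E₂ b)) (fun b ↦ (φ b).injective) hF hF₂ b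
    rw [← ModuleCat.comp_apply, ← singularCohomology.map_comp, hc, ht.map_complInf]
  map_complFibreIncl b := by
    have hc : (isoComplMap F E F₂ E₂ φ hΨ).comp (complFibreIncl F E b) = (complFibreIncl F₂ E₂ b).comp (projProd₂ (φ b)) := by
      ext1 ℓ
      change complMap F F₂ E E₂ (g := ContinuousMap.id B) (fun b ↦ ((φ b : E b →L[ℂ] E₂ b) : E b →ₗ[ℂ] E₂ b))
        (fun b ↦ (φ b).injective) ⟨b, ℓ⟩ = ⟨b, projProd₂ (φ b) ℓ⟩
      induction ℓ using Projectivization.ind with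
      | h v hv => rfl
    rw [← ModuleCat.comp_apply, ← singularCohomology.map_comp, hc, singularCohomology.map_comp, ModuleCat.comp_apply,
      ht.map_complFibreIncl, map_projProd₂_omegaFib F E hF R F₂ E₂ hF₂ φ b m]

variable [T2Space B] [ParacompactSpace B]

/-- **`(P φ)^* t(λ₂) = t(λ₁)` for an isomorphism `φ : λ₁ ≅ λ₂`.** [cite: HusemollerFibreBundles1994, Ch. 17 Prop. 3.3] -/
theorem thomClass_iso (m : R) :
    singularCohomology.map R R (isoComplMap F E F₂ E₂ φ hΨ) 2 (thomClass F₂ E₂ hF₂ R m) = thomClass F E hF R m :=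
  (isThomClass_map_isoComplMap F E hF R F₂ E₂ hF₂ φ hΨ (isThomClass_thomClass F₂ E₂ hF₂ R m)).eq_thomClass hF

include φ hΨ in
/-- **Invariance of the Euler / first Chern class of line bundles under isomorphism: `e(λ₁) = e(λ₂)`**
(given a fibrewise linear isomorphism `φ` with continuous total map; Husemoller (C₁)).
[cite: HusemollerFibreBundles1994, Ch. 17 Prop. 3.3] -/
theorem eulerClass_iso (m : R) : eulerClass F E hF R m = eulerClass F₂ E₂ hF₂ R m := by
  have hc : (isoComplMap F E F₂ E₂ φ hΨ).comp (complZero F E) = complZero F₂ E₂ :=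
    ContinuousMap.ext fun b ↦ complMap_complZero (F₁ := F) (F₂ := F₂) (E₁ := E) (E₂ := E₂) (g := ContinuousMap.id B)
      (fun b ↦ ((φ b : E b →L[ℂ] E₂ b) : E b →ₗ[ℂ] E₂ b)) (fun b ↦ (φ b).injective) b
  rw [eulerClass, eulerClass, ← thomClass_iso F E hF R F₂ E₂ hF₂ φ hΨ m, ← ModuleCat.comp_apply,
    ← singularCohomology.map_comp, hc]

end Iso

end Literature.AlgebraicTopology.CharacteristicClasses
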